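import Summits.CriticalPhenomena.PercolationContinuityZ3.Theorems.PercNearOneGluingNoHeavyLowerTailSizeDominance

/-!
# `NoHeavyLowerTail` (crux stmt-CriticalPhenomena-4575), lane prim-ineq-gen-4 (gen 16): the CONE HALF of the threshold
# recursion in counting form

Support file (`--supports stmt-CriticalPhenomena-4575`; memo `run/shared/lean/prim/prim-ineq-gen-4/FINDING-THRESHOLD-TREC-g16.md` §1a,
`PROOFS-TREC-FACES-g16.md` Lemma B).  Pure finite combinatorics on configurations `(x, S, T)` = ordered 3-partitions of a finite
type (encoded as disjoint pairs `(x,S)`, `T = (x ∪ S)ᶜ`), no definitions, standard axioms.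

THEOREM (`coneHalf_card_le`): for up-sets `B ⊆ B'` and `C'` of `Finset α`, a further family `C`, and a threshold `j`, with
`b = B' \ B`, `c = C' \ C` and all configurations restricted to `j ≤ #x`:
  `#{S ∈ b, T ∈ C'} + #{S ∈ B, T ∈ c} ≤ #{x ∈ B', S ∈ c} + #{x ∈ C', S ∈ b} + #{S ∈ b ∩ C'} + #{S ∈ B ∩ c}`.
By the lane's identity (memo §0 (B)) the right side minus the left side is `T_j(η¹) = c₁ − c₃` for the cone over the threshold
up-set `Θ_j` (`U = {x ∋ e : #(x \ e) ≥ j}`), i.e. this is `N_{m+1}(Θ_j + e; V, W) ≥ N_m(Θ_j; V¹, W¹)` in counting form.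
PROOF: four injections that permute the three parts (keeping the part carrying the size condition of size `≥ j`) and, for
the two residual classes (small third part), the level comparison `#F_t ≤ #F_{#Y − t}` for the up-closed fibres
`F = C'|_{𝒫(Y)}` resp. `B|_{𝒫(Y)}` (`…SizeDominance.card_level_le_card_mirror`).
-/

namespace Summit.CriticalPhenomena.PercolationContinuityZ3.Theorems.SizeDominance

open Finset

variable {α : Type*} [DecidableEq α]

/-- Level comparison for an up-closed family `F ⊆ 𝒫(Y)`: the members of size `t < j` with `t + j ≤ #Y` are at most as
many as the members of size `s ≥ j` with `#Y < s + j` (mirror levels `s = #Y − t`). [this work] -/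
theorem card_filter_small_le_card_filter_large (Y : Finset α) (F : Finset (Finset α)) (hF : ∀ y ∈ F, y ⊆ Y)
    (hup : ∀ y ∈ F, ∀ a ∈ Y, insert a y ∈ F) (j : ℕ) :
    #(F.filter fun y => #y < j ∧ #y + j ≤ #Y) ≤ #(F.filter fun y => j ≤ #y ∧ #Y < #y + j) := by
  set w := #Y with hw
  set I : Finset ℕ := (range (w + 1)).filter fun t => t < j ∧ t + j ≤ w with hI
  set I' : Finset ℕ := (range (w + 1)).filter fun s => j ≤ s ∧ w < s + j with hI'
  have hcard : ∀ y ∈ F, #y ≤ w := fun y hy => card_le_card (hF y hy)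
  have hl : #(F.filter fun y => #y < j ∧ #y + j ≤ w) = #(F.filter fun y => #y ∈ I) := by
    congr 1; ext y; simp only [mem_filter, hI, mem_range]
    constructor
    · rintro ⟨hy, h⟩; exact ⟨hy, Nat.lt_succ_of_le (hcard y hy), h⟩
    · rintro ⟨hy, -, h⟩; exact ⟨hy, h⟩
  have hr : #(F.filter fun y => j ≤ #y ∧ w < #y + j) = #(F.filter fun y => #y ∈ I') := by
    congr 1; ext y; simp only [mem_filter, hI', mem_range]
    constructor
    · rintro ⟨hy, h⟩; exact ⟨hy, Nat.lt_succ_of_le (hcard y hy), h⟩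
    · rintro ⟨hy, -, h⟩; exact ⟨hy, h⟩
  rw [hl, hr, card_filter_card_mem_eq_sum, card_filter_card_mem_eq_sum]
  have hmirror : ∑ t ∈ I, #(F.filter fun y => #y = t) ≤ ∑ t ∈ I, #(F.filter fun y => #y = w - t) := by
    refine sum_le_sum fun t ht => ?_
    rw [hI, mem_filter] at ht
    exact card_level_le_card_mirror Y F hup (by omega)
  have hinj : Set.InjOn (fun t => w - t) ↑I := by
    intro t ht t' ht' h
    rw [mem_coe, hI, mem_filter, mem_range] at ht ht'
    simp only at h
    omega
  have hsub : I.image (fun t => w - t) ⊆ I' := by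
    intro s hs
    rw [mem_image] at hs; obtain ⟨t, ht, rfl⟩ := hs
    rw [hI, mem_filter, mem_range] at ht
    rw [hI', mem_filter, mem_range]
    omega
  have himage : ∑ t ∈ I, #(F.filter fun y => #y = w - t) =
      ∑ s ∈ I.image (fun t => w - t), #(F.filter fun y => #y = s) := by
    rw [sum_image hinj]
  calc ∑ t ∈ I, #(F.filter fun y => #y = t)
      ≤ ∑ t ∈ I, #(F.filter fun y => #y = w - t) := hmirror
    _ = ∑ s ∈ I.image (fun t => w - t), #(F.filter fun y => #y = s) := himage
    _ ≤ ∑ s ∈ I', #(F.filter fun y => #y = s) := sum_le_sum_of_subset_of_nonneg hsub fun _ _ _ => Nat.zero_le _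

section Fintype

variable [Fintype α]

/-- Recovering the first part of a configuration from the other two. [folklore] -/
theorem fst_eq_compl_compl_sdiff (p : Finset α × Finset α) (hd : Disjoint p.1 p.2) :
    p.1 = (p.1 ∪ p.2)ᶜᶜ \ p.2 := by
  rw [compl_compl, union_sdiff_right, sdiff_eq_self_of_disjoint hd]


/-- Residual class (1c), fibre over the second part `S`: configurations `(x, S, T)` with `j ≤ #x`, `S ∈ b ∖ C'`, `T ∈ C'`,
`#T < j` are — via `T`, a small member of the up-closed family `C'|_{𝒫(Sᶜ)}` — at most as many as the configurations
`(x', S, T')` with `x' ∈ C'`, `j ≤ #x'`, `#T' < j` (via the large members `x'`). [this work] -/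
theorem card_fibre_1c_le (B B' C' : Finset (Finset α)) (hC' : IsUpperSet (C' : Set (Finset α))) (j : ℕ) (S : Finset α) :
    #(((((univ : Finset (Finset α × Finset α)).filter fun p =>
        Disjoint p.1 p.2 ∧ j ≤ #p.1 ∧ p.2 ∈ B' \ B ∧ (p.1 ∪ p.2)ᶜ ∈ C').filter fun p =>
        ¬ p.2 ∈ C').filter fun p => ¬ j ≤ #(p.1 ∪ p.2)ᶜ).filter fun p => p.2 = S) ≤
      #((((univ : Finset (Finset α × Finset α)).filter fun p =>
        Disjoint p.1 p.2 ∧ j ≤ #p.1 ∧ p.1 ∈ C' ∧ p.2 ∈ B' \ B).filter fun p =>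
        ¬ j ≤ #(p.1 ∪ p.2)ᶜ).filter fun p => p.2 = S) := by
  by_cases hS : S ∈ B' \ B
  swap
  · -- empty fibre
    rw [card_eq_zero.2]
    · exact Nat.zero_le _
    · refine filter_false_of_mem fun p hp => ?_
      simp only [mem_filter] at hp
      intro h; exact hS (h ▸ hp.1.1.2.2.2.1)
  set Y : Finset α := Sᶜ with hY
  set F : Finset (Finset α) := Y.powerset.filter fun y => y ∈ C' with hF
  have hFY : ∀ y ∈ F, y ⊆ Y := fun y hy => mem_powerset.1 (mem_filter.1 hy).1
  have hup : ∀ y ∈ F, ∀ a ∈ Y, insert a y ∈ F := by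
    intro y hy a ha
    rw [hF, mem_filter, mem_powerset] at hy ⊢
    exact ⟨insert_subset ha hy.1, insert_mem_of_isUpperSet hC' hy.2 a⟩
  have hcompl : ∀ x : Finset α, Disjoint x S → (x ∪ S)ᶜ = Y \ x := by
    intro x hx; ext a
    simp only [mem_compl, mem_union, mem_sdiff, hY, not_or]
    tauto
  have hsubY : ∀ x : Finset α, Disjoint x S → x ⊆ Y := by
    intro x hx a ha; rw [hY, mem_compl]; exact fun hS' => disjoint_left.1 hx ha hS'
  have h1 : #(((((univ : Finset (Finset α × Finset α)).filter fun p =>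
        Disjoint p.1 p.2 ∧ j ≤ #p.1 ∧ p.2 ∈ B' \ B ∧ (p.1 ∪ p.2)ᶜ ∈ C').filter fun p =>
        ¬ p.2 ∈ C').filter fun p => ¬ j ≤ #(p.1 ∪ p.2)ᶜ).filter fun p => p.2 = S) ≤
      #(F.filter fun y => #y < j ∧ #y + j ≤ #Y) := by
    refine card_le_card_of_injOn (fun p => (p.1 ∪ p.2)ᶜ) (fun p hp => ?_) (fun p hp p' hp' h => ?_)
    · have hp' := mem_coe.1 hp
      simp only [mem_filter, mem_univ, true_and] at hp'
      obtain ⟨⟨⟨⟨hd, hj, -, hC⟩, -⟩, hT⟩, hS2⟩ := hp'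
      subst hS2
      show (p.1 ∪ p.2)ᶜ ∈ F.filter fun y => #y < j ∧ #y + j ≤ #Y
      rw [mem_filter, hF, mem_filter, mem_powerset, hcompl p.1 hd]
      rw [hcompl p.1 hd] at hC hT
      refine ⟨⟨sdiff_subset, hC⟩, by omega, ?_⟩
      rw [card_sdiff_of_subset (hsubY p.1 hd)]; have := card_le_card (hsubY p.1 hd); omega
    · have hq := mem_coe.1 hp
      have hq' := mem_coe.1 hp'
      simp only [mem_filter, mem_univ, true_and] at hq hq'
      have h2 : p.2 = p'.2 := by rw [hq.2, hq'.2]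
      have hx : p.1 = (p.1 ∪ p.2)ᶜᶜ \ p.2 := by
        rw [compl_compl, union_sdiff_right, sdiff_eq_self_of_disjoint hq.1.1.1.1]
      have hx' : p'.1 = (p'.1 ∪ p'.2)ᶜᶜ \ p'.2 := by
        rw [compl_compl, union_sdiff_right, sdiff_eq_self_of_disjoint hq'.1.1.1.1]
      have h1' : p.1 = p'.1 := by
        rw [hx, hx']; simp only at h; rw [h, h2]
      exact Prod.ext h1' h2
  have h2 : #(F.filter fun y => j ≤ #y ∧ #Y < #y + j) ≤
      #((((univ : Finset (Finset α × Finset α)).filter fun p =>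
        Disjoint p.1 p.2 ∧ j ≤ #p.1 ∧ p.1 ∈ C' ∧ p.2 ∈ B' \ B).filter fun p =>
        ¬ j ≤ #(p.1 ∪ p.2)ᶜ).filter fun p => p.2 = S) := by
    refine card_le_card_of_injOn (fun y => (y, S)) (fun y hy => ?_) (fun y _ y' _ h => ?_)
    · have hy' := mem_coe.1 hy
      rw [mem_filter, hF, mem_filter, mem_powerset] at hy'
      obtain ⟨⟨hyY, hyC⟩, hj, hlt⟩ := hy'
      have hd : Disjoint y S := by
        rw [disjoint_left]; intro a ha hS'
        have := hyY ha; rw [hY, mem_compl] at this; exact this hS'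
      apply mem_coe.2
      simp only [mem_filter, mem_univ, true_and]
      refine ⟨⟨⟨hd, hj, hyC, hS⟩, ?_⟩, trivial⟩
      show ¬ j ≤ #(y ∪ S)ᶜ
      rw [hcompl y hd, card_sdiff_of_subset hyY]; have := card_le_card hyY; omega
    · exact (Prod.ext_iff.1 h).1
  exact le_trans h1 (le_trans (card_filter_small_le_card_filter_large Y F hFY hup j) h2)

/-- Residual class (2c), fibre over the THIRD part `T`: configurations `(x, S, T)` with `j ≤ #x`, `S ∈ B ∖ c`, `T ∈ c`, `#S < j`
are — via `S`, a small member of `B|_{𝒫(Tᶜ)}` — at most as many as the configurations `(x', T, ·)` with `x' ∈ B ⊆ B'`,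
`j ≤ #x'`, third part of size `< j`. [this work] -/
theorem card_fibre_2c_le (B B' C C' : Finset (Finset α)) (hB : IsUpperSet (B : Set (Finset α))) (hBB' : B ⊆ B') (j : ℕ)
    (T : Finset α) :
    #(((((univ : Finset (Finset α × Finset α)).filter fun p =>
        Disjoint p.1 p.2 ∧ j ≤ #p.1 ∧ p.2 ∈ B ∧ (p.1 ∪ p.2)ᶜ ∈ C' \ C).filter fun p =>
        ¬ p.2 ∈ C' \ C).filter fun p => ¬ j ≤ #p.2).filter fun p => (p.1 ∪ p.2)ᶜ = T) ≤
      #((((univ : Finset (Finset α × Finset α)).filter fun p =>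
        Disjoint p.1 p.2 ∧ j ≤ #p.1 ∧ p.1 ∈ B' ∧ p.2 ∈ C' \ C).filter fun p =>
        ¬ j ≤ #(p.1 ∪ p.2)ᶜ).filter fun p => p.2 = T) := by
  by_cases hT : T ∈ C' \ C
  swap
  · rw [card_eq_zero.2]
    · exact Nat.zero_le _
    · refine filter_false_of_mem fun p hp => ?_
      simp only [mem_filter] at hp
      intro h; exact hT (h ▸ hp.1.1.2.2.2.2)
  set Y : Finset α := Tᶜ with hY
  set F : Finset (Finset α) := Y.powerset.filter fun y => y ∈ B with hF
  have hFY : ∀ y ∈ F, y ⊆ Y := fun y hy => mem_powerset.1 (mem_filter.1 hy).1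
  have hup : ∀ y ∈ F, ∀ a ∈ Y, insert a y ∈ F := by
    intro y hy a ha
    rw [hF, mem_filter, mem_powerset] at hy ⊢
    exact ⟨insert_subset ha hy.1, insert_mem_of_isUpperSet hB hy.2 a⟩
  -- for a configuration with third part `T`: `x ∪ S = Y`, so `x = Y \ S`, `#x = #Y - #S`
  have h1 : #(((((univ : Finset (Finset α × Finset α)).filter fun p =>
        Disjoint p.1 p.2 ∧ j ≤ #p.1 ∧ p.2 ∈ B ∧ (p.1 ∪ p.2)ᶜ ∈ C' \ C).filter fun p =>
        ¬ p.2 ∈ C' \ C).filter fun p => ¬ j ≤ #p.2).filter fun p => (p.1 ∪ p.2)ᶜ = T) ≤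
      #(F.filter fun y => #y < j ∧ #y + j ≤ #Y) := by
    refine card_le_card_of_injOn (fun p => p.2) (fun p hp => ?_) (fun p hp p' hp' h => ?_)
    · have hp' := mem_coe.1 hp
      simp only [mem_filter, mem_univ, true_and] at hp'
      obtain ⟨⟨⟨⟨hd, hj, hB2, -⟩, -⟩, hS⟩, hT'⟩ := hp'
      have hYeq : p.1 ∪ p.2 = Y := by rw [hY, ← hT', compl_compl]
      have hx : p.1 = Y \ p.2 := by rw [← hYeq, union_sdiff_right, sdiff_eq_self_of_disjoint hd]
      show p.2 ∈ F.filter fun y => #y < j ∧ #y + j ≤ #Y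
      rw [mem_filter, hF, mem_filter, mem_powerset]
      have hsub : p.2 ⊆ Y := hYeq ▸ subset_union_right
      refine ⟨⟨hsub, hB2⟩, by omega, ?_⟩
      rw [hx, card_sdiff_of_subset hsub] at hj; have := card_le_card hsub; omega
    · have hq := mem_coe.1 hp
      have hq' := mem_coe.1 hp'
      simp only [mem_filter, mem_univ, true_and] at hq hq'
      simp only at h
      have h1' : p.1 = p'.1 := by
        rw [fst_eq_compl_compl_sdiff p hq.1.1.1.1, fst_eq_compl_compl_sdiff p' hq'.1.1.1.1, hq.2, hq'.2, h]
      exact Prod.ext h1' h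
  have h2 : #(F.filter fun y => j ≤ #y ∧ #Y < #y + j) ≤
      #((((univ : Finset (Finset α × Finset α)).filter fun p =>
        Disjoint p.1 p.2 ∧ j ≤ #p.1 ∧ p.1 ∈ B' ∧ p.2 ∈ C' \ C).filter fun p =>
        ¬ j ≤ #(p.1 ∪ p.2)ᶜ).filter fun p => p.2 = T) := by
    refine card_le_card_of_injOn (fun y => (y, T)) (fun y hy => ?_) (fun y _ y' _ h => ?_)
    · have hy' := mem_coe.1 hy
      rw [mem_filter, hF, mem_filter, mem_powerset] at hy'
      obtain ⟨⟨hyY, hyB⟩, hj, hlt⟩ := hy'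
      have hd : Disjoint y T := by
        rw [disjoint_left]; intro a ha hT2
        have := hyY ha; rw [hY, mem_compl] at this; exact this hT2
      have hcompl : (y ∪ T)ᶜ = Y \ y := by
        ext a; simp only [mem_compl, mem_union, mem_sdiff, hY, not_or]; tauto
      apply mem_coe.2
      simp only [mem_filter, mem_univ, true_and]
      refine ⟨⟨⟨hd, hj, hBB' hyB, hT⟩, ?_⟩, trivial⟩
      show ¬ j ≤ #(y ∪ T)ᶜ
      rw [hcompl, card_sdiff_of_subset hyY]; have := card_le_card hyY; omega
    · exact (Prod.ext_iff.1 h).1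
  exact le_trans h1 (le_trans (card_filter_small_le_card_filter_large Y F hFY hup j) h2)

/-- (1a): `S ∈ b ∩ C'` configurations lie in the third target class. [this work] -/
theorem card_1a_le (B B' C' : Finset (Finset α)) (j : ℕ) :
    #(((univ : Finset (Finset α × Finset α)).filter fun p =>
        Disjoint p.1 p.2 ∧ j ≤ #p.1 ∧ p.2 ∈ B' \ B ∧ (p.1 ∪ p.2)ᶜ ∈ C').filter fun p => p.2 ∈ C') ≤ #((univ : Finset (Finset α × Finset α)).filter fun p =>
        Disjoint p.1 p.2 ∧ j ≤ #p.1 ∧ p.2 ∈ (B' \ B) ∩ C') := by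
  refine card_le_card fun p hp => ?_
  rw [mem_filter, mem_filter] at hp
  rw [mem_filter, mem_inter]
  exact ⟨hp.1.1, hp.1.2.1, hp.1.2.2.1, hp.1.2.2.2.1, hp.2⟩

/-- (2a): `S ∈ B ∩ c` configurations lie in the fourth target class. [this work] -/
theorem card_2a_le (B C C' : Finset (Finset α)) (j : ℕ) :
    #(((univ : Finset (Finset α × Finset α)).filter fun p =>
        Disjoint p.1 p.2 ∧ j ≤ #p.1 ∧ p.2 ∈ B ∧ (p.1 ∪ p.2)ᶜ ∈ C' \ C).filter fun p => p.2 ∈ C' \ C) ≤ #((univ : Finset (Finset α × Finset α)).filter fun p =>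
        Disjoint p.1 p.2 ∧ j ≤ #p.1 ∧ p.2 ∈ B ∩ (C' \ C)) := by
  refine card_le_card fun p hp => ?_
  rw [mem_filter, mem_filter] at hp
  rw [mem_filter, mem_inter]
  exact ⟨hp.1.1, hp.1.2.1, hp.1.2.2.1, hp.1.2.2.2.1, hp.2⟩

/-- (1b): `(x,S,T) ↦ (T,S,x)` sends the configurations with `S ∈ b ∖ C'`, `T ∈ C'`, `#T ≥ j` injectively into the second target
class (third part of size `≥ j`). [this work] -/
theorem card_1b_le (B B' C' : Finset (Finset α)) (j : ℕ) :
    #((((univ : Finset (Finset α × Finset α)).filter fun p =>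
        Disjoint p.1 p.2 ∧ j ≤ #p.1 ∧ p.2 ∈ B' \ B ∧ (p.1 ∪ p.2)ᶜ ∈ C').filter fun p => ¬ p.2 ∈ C').filter fun p => j ≤ #(p.1 ∪ p.2)ᶜ) ≤
      #(((univ : Finset (Finset α × Finset α)).filter fun p =>
        Disjoint p.1 p.2 ∧ j ≤ #p.1 ∧ p.1 ∈ C' ∧ p.2 ∈ B' \ B).filter fun p => j ≤ #(p.1 ∪ p.2)ᶜ) := by
  refine card_le_card_of_injOn (fun p => ((p.1 ∪ p.2)ᶜ, p.2)) (fun p hp => ?_) (fun p hp p' hp' h => ?_)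
  · have hq := mem_coe.1 hp
    rw [mem_filter, mem_filter, mem_filter] at hq
    obtain ⟨⟨⟨-, hd, hj, hb, hC⟩, -⟩, hT⟩ := hq
    apply mem_coe.2
    rw [mem_filter, mem_filter]
    have hd' : Disjoint (p.1 ∪ p.2)ᶜ p.2 :=
      disjoint_left.2 fun a ha ha2 => (mem_compl.1 ha) (mem_union_right _ ha2)
    have hx : ((p.1 ∪ p.2)ᶜ ∪ p.2)ᶜ = p.1 := by
      rw [compl_union, compl_compl, ← sdiff_eq_inter_compl, union_sdiff_right, sdiff_eq_self_of_disjoint hd]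
    refine ⟨⟨mem_univ _, hd', hT, hC, hb⟩, ?_⟩
    show j ≤ #((p.1 ∪ p.2)ᶜ ∪ p.2)ᶜ
    rw [hx]; exact hj
  · have hq := mem_coe.1 hp
    have hq' := mem_coe.1 hp'
    rw [mem_filter, mem_filter, mem_filter] at hq hq'
    simp only [Prod.mk.injEq] at h
    have e1 : p.1 = p'.1 := by
      rw [fst_eq_compl_compl_sdiff p hq.1.1.2.1, fst_eq_compl_compl_sdiff p' hq'.1.1.2.1, h.1, h.2]
    exact Prod.ext e1 h.2

/-- (2b): `(x,S,T) ↦ (S,T,x)` sends the configurations with `S ∈ B ∖ c`, `T ∈ c`, `#S ≥ j` injectively into the first target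
class (third part of size `≥ j`). [this work] -/
theorem card_2b_le (B B' C C' : Finset (Finset α)) (hBB' : B ⊆ B') (j : ℕ) :
    #((((univ : Finset (Finset α × Finset α)).filter fun p =>
        Disjoint p.1 p.2 ∧ j ≤ #p.1 ∧ p.2 ∈ B ∧ (p.1 ∪ p.2)ᶜ ∈ C' \ C).filter fun p => ¬ p.2 ∈ C' \ C).filter fun p => j ≤ #p.2) ≤
      #(((univ : Finset (Finset α × Finset α)).filter fun p =>
        Disjoint p.1 p.2 ∧ j ≤ #p.1 ∧ p.1 ∈ B' ∧ p.2 ∈ C' \ C).filter fun p => j ≤ #(p.1 ∪ p.2)ᶜ) := by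
  refine card_le_card_of_injOn (fun p => (p.2, (p.1 ∪ p.2)ᶜ)) (fun p hp => ?_) (fun p hp p' hp' h => ?_)
  · have hq := mem_coe.1 hp
    rw [mem_filter, mem_filter, mem_filter] at hq
    obtain ⟨⟨⟨-, hd, hj, hB2, hc⟩, -⟩, hS⟩ := hq
    apply mem_coe.2
    rw [mem_filter, mem_filter]
    have hd' : Disjoint p.2 (p.1 ∪ p.2)ᶜ :=
      disjoint_left.2 fun a ha2 ha => (mem_compl.1 ha) (mem_union_right _ ha2)
    have hx : (p.2 ∪ (p.1 ∪ p.2)ᶜ)ᶜ = p.1 := by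
      rw [compl_union, compl_compl, inter_comm, ← sdiff_eq_inter_compl, union_sdiff_right,
        sdiff_eq_self_of_disjoint hd]
    refine ⟨⟨mem_univ _, hd', hS, hBB' hB2, hc⟩, ?_⟩
    show j ≤ #(p.2 ∪ (p.1 ∪ p.2)ᶜ)ᶜ
    rw [hx]; exact hj
  · have hq := mem_coe.1 hp
    have hq' := mem_coe.1 hp'
    rw [mem_filter, mem_filter, mem_filter] at hq hq'
    simp only [Prod.mk.injEq] at h
    have e1 : p.1 = p'.1 := by
      rw [fst_eq_compl_compl_sdiff p hq.1.1.2.1, fst_eq_compl_compl_sdiff p' hq'.1.1.2.1, h.2, h.1]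
    exact Prod.ext e1 h.1

/-- (1c) summed over the fibres `S`. [this work] -/
theorem card_1c_le (B B' C' : Finset (Finset α)) (hC' : IsUpperSet (C' : Set (Finset α))) (j : ℕ) :
    #((((univ : Finset (Finset α × Finset α)).filter fun p =>
        Disjoint p.1 p.2 ∧ j ≤ #p.1 ∧ p.2 ∈ B' \ B ∧ (p.1 ∪ p.2)ᶜ ∈ C').filter fun p => ¬ p.2 ∈ C').filter fun p => ¬ j ≤ #(p.1 ∪ p.2)ᶜ) ≤
      #(((univ : Finset (Finset α × Finset α)).filter fun p =>
        Disjoint p.1 p.2 ∧ j ≤ #p.1 ∧ p.1 ∈ C' ∧ p.2 ∈ B' \ B).filter fun p => ¬ j ≤ #(p.1 ∪ p.2)ᶜ) := by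
  rw [card_eq_sum_card_fiberwise (f := fun p : Finset α × Finset α => p.2) (t := univ)
      (fun p _ => mem_coe.2 (mem_univ _)),
    card_eq_sum_card_fiberwise (f := fun p : Finset α × Finset α => p.2) (t := univ)
      (fun p _ => mem_coe.2 (mem_univ _))]
  exact sum_le_sum fun S _ => card_fibre_1c_le B B' C' hC' j S

/-- (2c) summed over the fibres `T`. [this work] -/
theorem card_2c_le (B B' C C' : Finset (Finset α)) (hB : IsUpperSet (B : Set (Finset α))) (hBB' : B ⊆ B') (j : ℕ) :
    #((((univ : Finset (Finset α × Finset α)).filter fun p =>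
        Disjoint p.1 p.2 ∧ j ≤ #p.1 ∧ p.2 ∈ B ∧ (p.1 ∪ p.2)ᶜ ∈ C' \ C).filter fun p => ¬ p.2 ∈ C' \ C).filter fun p => ¬ j ≤ #p.2) ≤
      #(((univ : Finset (Finset α × Finset α)).filter fun p =>
        Disjoint p.1 p.2 ∧ j ≤ #p.1 ∧ p.1 ∈ B' ∧ p.2 ∈ C' \ C).filter fun p => ¬ j ≤ #(p.1 ∪ p.2)ᶜ) := by
  rw [card_eq_sum_card_fiberwise (f := fun p : Finset α × Finset α => (p.1 ∪ p.2)ᶜ) (t := univ)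
      (fun p _ => mem_coe.2 (mem_univ _)),
    card_eq_sum_card_fiberwise (f := fun p : Finset α × Finset α => p.2) (t := univ)
      (fun p _ => mem_coe.2 (mem_univ _))]
  exact sum_le_sum fun T _ => card_fibre_2c_le B B' C C' hB hBB' j T

/-- **CONE HALF OF THE THRESHOLD RECURSION, COUNTING FORM** (Lemma B of the lane's memo).  For up-sets `B ⊆ B'`, `C'` and a
family `C` of `Finset α`, put `b = B' \ B`, `c = C' \ C`; configurations are disjoint pairs `(x, S)` (third part
`T = (x ∪ S)ᶜ`) restricted to `j ≤ #x`.  Then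
`#{S ∈ b, T ∈ C'} + #{S ∈ B, T ∈ c} ≤ #{x ∈ B', S ∈ c} + #{x ∈ C', S ∈ b} + #{S ∈ b ∩ C'} + #{S ∈ B ∩ c}`
— which by the lane's identity is `N_{m+1}(Θ_j + e; V, W) ≥ N_m(Θ_j; V¹, W¹)` (the cone over a threshold up-set dominates
its top section) for `V = (B ⊆ B')`, `W = (C ⊆ C')`. [this work] -/
theorem coneHalf_card_le (B B' C C' : Finset (Finset α)) (hB : IsUpperSet (B : Set (Finset α)))
    (hC' : IsUpperSet (C' : Set (Finset α))) (hBB' : B ⊆ B') (j : ℕ) :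
    #((univ : Finset (Finset α × Finset α)).filter fun p =>
        Disjoint p.1 p.2 ∧ j ≤ #p.1 ∧ p.2 ∈ B' \ B ∧ (p.1 ∪ p.2)ᶜ ∈ C') + #((univ : Finset (Finset α × Finset α)).filter fun p =>
        Disjoint p.1 p.2 ∧ j ≤ #p.1 ∧ p.2 ∈ B ∧ (p.1 ∪ p.2)ᶜ ∈ C' \ C) ≤ #((univ : Finset (Finset α × Finset α)).filter fun p =>
        Disjoint p.1 p.2 ∧ j ≤ #p.1 ∧ p.1 ∈ B' ∧ p.2 ∈ C' \ C) + #((univ : Finset (Finset α × Finset α)).filter fun p =>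
        Disjoint p.1 p.2 ∧ j ≤ #p.1 ∧ p.1 ∈ C' ∧ p.2 ∈ B' \ B) + #((univ : Finset (Finset α × Finset α)).filter fun p =>
        Disjoint p.1 p.2 ∧ j ≤ #p.1 ∧ p.2 ∈ (B' \ B) ∩ C') + #((univ : Finset (Finset α × Finset α)).filter fun p =>
        Disjoint p.1 p.2 ∧ j ≤ #p.1 ∧ p.2 ∈ B ∩ (C' \ C)) := by
  have sL1 := card_filter_add_card_filter_not (s := ((univ : Finset (Finset α × Finset α)).filter fun p =>
        Disjoint p.1 p.2 ∧ j ≤ #p.1 ∧ p.2 ∈ B' \ B ∧ (p.1 ∪ p.2)ᶜ ∈ C')) (fun p : Finset α × Finset α => p.2 ∈ C')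
  have sL1' := card_filter_add_card_filter_not (s := ((univ : Finset (Finset α × Finset α)).filter fun p =>
        Disjoint p.1 p.2 ∧ j ≤ #p.1 ∧ p.2 ∈ B' \ B ∧ (p.1 ∪ p.2)ᶜ ∈ C').filter fun p => ¬ p.2 ∈ C')
    (fun p : Finset α × Finset α => j ≤ #(p.1 ∪ p.2)ᶜ)
  have sL2 := card_filter_add_card_filter_not (s := ((univ : Finset (Finset α × Finset α)).filter fun p =>
        Disjoint p.1 p.2 ∧ j ≤ #p.1 ∧ p.2 ∈ B ∧ (p.1 ∪ p.2)ᶜ ∈ C' \ C)) (fun p : Finset α × Finset α => p.2 ∈ C' \ C)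
  have sL2' := card_filter_add_card_filter_not (s := ((univ : Finset (Finset α × Finset α)).filter fun p =>
        Disjoint p.1 p.2 ∧ j ≤ #p.1 ∧ p.2 ∈ B ∧ (p.1 ∪ p.2)ᶜ ∈ C' \ C).filter fun p => ¬ p.2 ∈ C' \ C)
    (fun p : Finset α × Finset α => j ≤ #p.2)
  have sR1 := card_filter_add_card_filter_not (s := ((univ : Finset (Finset α × Finset α)).filter fun p =>
        Disjoint p.1 p.2 ∧ j ≤ #p.1 ∧ p.1 ∈ B' ∧ p.2 ∈ C' \ C)) (fun p : Finset α × Finset α => j ≤ #(p.1 ∪ p.2)ᶜ)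
  have sR2 := card_filter_add_card_filter_not (s := ((univ : Finset (Finset α × Finset α)).filter fun p =>
        Disjoint p.1 p.2 ∧ j ≤ #p.1 ∧ p.1 ∈ C' ∧ p.2 ∈ B' \ B)) (fun p : Finset α × Finset α => j ≤ #(p.1 ∪ p.2)ᶜ)
  have h1a := card_1a_le B B' C' j
  have h2a := card_2a_le B C C' j
  have h1b := card_1b_le B B' C' j
  have h2b := card_2b_le B B' C C' hBB' j
  have h1c := card_1c_le B B' C' hC' j
  have h2c := card_2c_le B B' C C' hB hBB' j
  omega

end Fintype

end Summit.CriticalPhenomena.PercolationContinuityZ3.Theorems.SizeDominance
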